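import Mathlib
import HarnessLib
import Literature.Probability.Percolation.MinOpenCut
import Literature.Probability.Percolation.MinOpenCutMenger
import Literature.Probability.Percolation.SharpnessDCTProofs
import Literature.Probability.Percolation.LatticeSymmetry
import Literature.Probability.Percolation.SitePaths

/-!
# `stub_sixLids` of line `Sketch` (crux `BudgetTightness`, stmt-CriticalPhenomena-5248):
# the six-lid inequality `E_p[MinCut(h+1, 2h+2)] ≤ 6 · E_p[S(4h+4, h)]`

Registered stub of the lead's skeleton `Cruxes/BudgetTightness/Lines/Sketch.lean`. For every `p`
and thickness `h ≥ 1`, the expected min-cut budget of the annulus `box (h+1) → ∂ⁱⁿ box (2h+2)`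
inside `box (2h+2)` of `ℤ³` is at most six times the expected bottom-to-top min-cut budget of the
slab piece `Q(4h+4, h) = [0, 4h+4]² × [0, h]`.
* ROUTING (lattice configurations `ω ⊆ E(ℤ³)`, `routing`): an open path inside `box (2h+2)` from
  `box (h+1)` to `∂ⁱⁿ box (2h+2)` ends on a face `{s x_i = 2h+2}`; after its last visit to
  `{s x_i ≤ h+1}` (`PathIn.last_exit`) it crosses the lid `{s x_i ≥ h+2} ∩ box (2h+2)` from the
  layer `{s x_i = h+2}` to `{s x_i = 2h+2}`. The lid with its two layers is the image of the
  reference piece under the lattice automorphism `Φ_{i,s} = σ_{i,s} ∘ (· + w_h)` (`zdSignedPermIso`,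
  `zdShiftIso`; `symm_mem_Icc`), so the union of optimal cutsets of the six image pieces is an
  annulus cutset: `MinCut(annulus) ≤ Σ_{six lids} MinCut(lid)` a.s. (`minOpenCutIn_le_sum_of_subRouting`).
* TRANSPORT: `MinCut_{φS}(φA, φB)(φ '' ω) = MinCut_S(A, B)(ω)` for a bijection `φ`
  (`minOpenCutIn_image_relabel`) and `P_p ∘ (φ '' ·)⁻¹ = P_p` for an automorphism
  (`bondPercolation_map_relabel_iso`): each lid has expected budget `E_p[S(4h+4, h)]`
  (`integral_toNat_minOpenCutIn_image`). Budgets of finite regions are bounded by the number of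
  pairs, hence integrable; the lid budgets are finite since bottom and top are disjoint (`h ≥ 1`).
-/

noncomputable section

namespace Summit.CriticalPhenomena.PercolationContinuityZ3.Theorems.BudgetTightness

open MeasureTheory ProbabilityTheory
open Literature.Probability.Percolation Literature.Probability.LatticeModels

namespace StubSixLids

/-! ### General min-cut tools (any vertex type) -/

section General

variable {V W : Type*}

/-- **Budgets add along a routing of sub-configurations** (variant of
`minOpenCutIn_le_sum_of_routing` whose routing hypothesis is only asked of the `ω' ⊆ ω`, the only
configurations it is applied to): if every `ω' ⊆ ω` joining `A` to `B` inside `S` joins some `A i`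
to `B i` inside `S i`, then `MinCut_S(A, B)(ω) ≤ ∑ᵢ MinCut_{S i}(A i, B i)(ω)`. -/
theorem minOpenCutIn_le_sum_of_subRouting {ι : Type*} [Fintype ι] {S A B : Set V}
    {Si Ai Bi : ι → Set V} {ω : BondConfig V}
    (hroute : ∀ ω' ⊆ ω, (∃ x ∈ A, ∃ y ∈ B, ω' ∈ openConnIn S x y) →
      ∃ i, ∃ x ∈ Ai i, ∃ y ∈ Bi i, ω' ∈ openConnIn (Si i) x y) :
    minOpenCutIn S A B ω ≤ ∑ i, minOpenCutIn (Si i) (Ai i) (Bi i) ω := by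
  classical
  by_cases htop : ∃ i, minOpenCutIn (Si i) (Ai i) (Bi i) ω = ⊤
  · obtain ⟨i, hi⟩ := htop
    rw [ENat.sum_eq_top.2 ⟨i, Finset.mem_univ i, hi⟩]
    exact le_top
  push Not at htop
  choose T hT hcard using fun i => exists_eq_minOpenCutIn (htop i)
  have hU : IsOpenCutsetIn S A B ω ↑(Finset.univ.biUnion T) := by
    intro x hx y hy hconn
    obtain ⟨i, x', hx', y', hy', h'⟩ := hroute _ Set.sdiff_subset ⟨x, hx, y, hy, hconn⟩
    exact hT i x' hx' y' hy' (isUpperSet_openConnIn _ _ _ (Set.sdiff_subset_sdiff_right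
      (Finset.coe_subset.2 (Finset.subset_biUnion_of_mem T (Finset.mem_univ i)))) h')
  calc minOpenCutIn S A B ω ≤ (Finset.univ.biUnion T).card := minOpenCutIn_le_card hU
    _ ≤ ((∑ i, (T i).card : ℕ) : ℕ∞) := by exact_mod_cast Finset.card_biUnion_le
    _ = ∑ i, minOpenCutIn (Si i) (Ai i) (Bi i) ω := by
        rw [Nat.cast_sum]
        exact Finset.sum_congr rfl fun i _ => hcard i

-- adapted from Theorems/PercBudgetLadderBudgetTightnessStubPatchCutset.lean (same transport argument)
/-- **Transport of the budget along a bijection of the vertices, `≤`**: `ω ↦ φ '' ω` carries open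
cutsets of `(S, A, B)` to open cutsets of `(φS, φA, φB)` of the same size. -/
theorem minOpenCutIn_image_relabel_le (e : V ≃ W) (S A B : Set V) (ω : BondConfig V) :
    minOpenCutIn (e '' S) (e '' A) (e '' B) (BondConfig.relabel (sym2Equiv e) ω) ≤
      minOpenCutIn S A B ω := by
  classical
  refine le_iInf₂ fun T hT => ?_
  have h1 : IsOpenCutsetIn (e '' S) (e '' A) (e '' B) (BondConfig.relabel (sym2Equiv e) ω)
      ↑(T.image (sym2Equiv e)) := by
    rintro _ ⟨x, hx, rfl⟩ _ ⟨y, hy, rfl⟩ hconn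
    have h' := relabel_mem_openConnIn e.symm hconn
    have key : BondConfig.relabel (sym2Equiv e.symm)
        (BondConfig.relabel (sym2Equiv e) ω \ ↑(T.image (sym2Equiv e))) = ω \ ↑T := by
      rw [BondConfig.relabel_apply, BondConfig.relabel_apply, Finset.coe_image,
        ← Set.image_sdiff (sym2Equiv e).injective, ← sym2Equiv_symm, Equiv.symm_image_image]
    rw [key, Equiv.symm_image_image, Equiv.symm_apply_apply, Equiv.symm_apply_apply] at h'
    exact hT x hx y hy h'
  calc minOpenCutIn (e '' S) (e '' A) (e '' B) (BondConfig.relabel (sym2Equiv e) ω)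
        ≤ (T.image (sym2Equiv e)).card := minOpenCutIn_le_card h1
    _ = T.card := by rw [Finset.card_image_of_injective _ (sym2Equiv e).injective]

/-- **Transport of the budget along a bijection of the vertices**:
`MinCut_{φS}(φA, φB)(φ '' ω) = MinCut_S(A, B)(ω)`. -/
theorem minOpenCutIn_image_relabel (e : V ≃ W) (S A B : Set V) (ω : BondConfig V) :
    minOpenCutIn (e '' S) (e '' A) (e '' B) (BondConfig.relabel (sym2Equiv e) ω) =
      minOpenCutIn S A B ω := by
  refine le_antisymm (minOpenCutIn_image_relabel_le e S A B ω) ?_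
  have h := minOpenCutIn_image_relabel_le e.symm (e '' S) (e '' A) (e '' B)
    (BondConfig.relabel (sym2Equiv e) ω)
  rwa [Equiv.symm_image_image, Equiv.symm_image_image, Equiv.symm_image_image,
    relabel_symm_relabel] at h

-- the next two proofs are adapted from Theorems/PercBudgetLadderBudgetTightnessStubPatchCutset.lean
/-- **Uniform bound on a finite region**: `MinCut_S(A, B)(ω).toNat ≤ #pairs(S)` (either the budget
is `⊤`, with `toNat = 0`, or `A ∩ B ∩ S = ∅` and closing all pairs inside `S` is an open cutset). -/
theorem toNat_minOpenCutIn_le_card {S : Set V} (hS : S.Finite) (A B : Set V) (ω : BondConfig V) :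
    ((minOpenCutIn S A B ω).toNat : ℝ) ≤ hS.toFinset.sym2.card := by
  by_cases htop : minOpenCutIn S A B ω = ⊤
  · simp [htop]
  have hAB : ¬ ∃ a ∈ S, a ∈ A ∧ a ∈ B := fun h =>
    htop ((minOpenCutIn_eq_top_iff_of_finite hS A B ω).2 h)
  refine Nat.cast_le.2 (ENat.toNat_le_of_le_coe (minOpenCutIn_le_card fun x hx y hy hω => ?_))
  obtain ⟨hxS, hyS, ⟨p⟩⟩ := hω
  cases p with
  | nil => exact hAB ⟨x, hxS, hx, hy⟩
  | cons hadj _ =>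
    rw [SimpleGraph.induce_adj, openGraph_adj] at hadj
    refine hadj.1.2 ?_
    rw [Finset.mem_coe, Finset.mk_mem_sym2_iff, Set.Finite.mem_toFinset, Set.Finite.mem_toFinset]
    exact ⟨hxS, Subtype.prop _⟩

/-- **Integrability of the real-valued budget of a finite region under `P_p`**: it is measurable
(its level sets are the cylinder events of `measurableSet_setOf_minOpenCutIn_le`) and bounded. -/
theorem integrable_toNat_minOpenCutIn {S : Set V} (hS : S.Finite) (A B : Set V) (G : SimpleGraph V)
    (p : unitInterval) : Integrable (fun ω => ((minOpenCutIn S A B ω).toNat : ℝ)) (bondPercolation G p) := by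
  have hle : ∀ z : ℕ∞, MeasurableSet {ω : BondConfig V | minOpenCutIn S A B ω ≤ z} := by
    intro z
    induction z using ENat.recTopCoe with
    | top => simp
    | coe k => exact measurableSet_setOf_minOpenCutIn_le hS A B k
  have hmeas : Measurable (minOpenCutIn S A B) := by
    refine measurable_to_countable' fun z => ?_
    have : minOpenCutIn S A B ⁻¹' {z} =
        {ω | minOpenCutIn S A B ω ≤ z} \ ⋃ w ∈ {w | w < z}, {ω | minOpenCutIn S A B ω ≤ w} := by
      ext ω
      simp only [Set.mem_preimage, Set.mem_singleton_iff, Set.mem_sdiff, Set.mem_setOf_eq,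
        Set.mem_iUnion, exists_prop, not_exists, not_and]
      exact ⟨fun h => ⟨h.le, fun w hw hle' => absurd (hle'.trans_lt hw) (h ▸ lt_irrefl _)⟩,
        fun h => le_antisymm h.1 (not_lt.1 fun hlt => h.2 _ hlt le_rfl)⟩
    rw [this]
    exact (hle z).diff (MeasurableSet.biUnion (Set.to_countable _) fun w _ => hle w)
  have hm : Measurable fun ω => ((minOpenCutIn S A B ω).toNat : ℝ) :=
    (measurable_of_countable fun j : ℕ => (j : ℝ)).comp
      ((measurable_of_countable ENat.toNat).comp hmeas)
  refine Integrable.of_bound hm.aestronglyMeasurable (hS.toFinset.sym2.card : ℝ)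
    (Filter.Eventually.of_forall fun ω => ?_)
  rw [Real.norm_eq_abs, abs_of_nonneg (Nat.cast_nonneg _)]
  exact toNat_minOpenCutIn_le_card hS A B ω

/-- **Invariance of expected budgets under graph isomorphisms**: for `φ : G ≃g G'`,
`E_p^{G'}[MinCut_{φS}(φA, φB)] = E_p^{G}[MinCut_S(A, B)]` (`P_p^G ∘ (φ '' ·)⁻¹ = P_p^{G'}`,
`bondPercolation_map_relabel_iso` and `minOpenCutIn_image_relabel`). -/
theorem integral_toNat_minOpenCutIn_image {G : SimpleGraph V} {G' : SimpleGraph W} (φ : G ≃g G')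
    (p : unitInterval) (S A B : Set V) :
    ∫ ω, ((minOpenCutIn (φ '' S) (φ '' A) (φ '' B) ω).toNat : ℝ) ∂(bondPercolation G' p) =
      ∫ ω, ((minOpenCutIn S A B ω).toNat : ℝ) ∂(bondPercolation G p) := by
  rw [← bondPercolation_map_relabel_iso φ p, integral_map_equiv]
  refine integral_congr_ae (Filter.Eventually.of_forall fun ω => ?_)
  exact congrArg (fun n : ℕ∞ => (n.toNat : ℝ)) (minOpenCutIn_image_relabel φ.toEquiv S A B ω)

/-- The budget of an injective image of a finite region with disjoint sources and sinks is finite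
(`minOpenCutIn_eq_top_iff_of_finite`). -/
theorem minOpenCutIn_image_ne_top {f : V → W} (hf : Function.Injective f) {S A B : Set V}
    (hS : S.Finite) (hAB : ∀ a, a ∈ A → a ∉ B) (ω : BondConfig W) :
    minOpenCutIn (f '' S) (f '' A) (f '' B) ω ≠ ⊤ := by
  rw [Ne, minOpenCutIn_eq_top_iff_of_finite (hS.image f)]
  rintro ⟨_, -, ⟨b, hb, rfl⟩, ⟨t, ht, hbt⟩⟩
  obtain rfl : t = b := hf hbt
  exact hAB t hb ht

end General

/-! ### Geometry of `ℤ³`: the reference piece and the six lids -/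

/-- Membership in a box `Set.Icc ![a₀, a₁, a₂] ![b₀, b₁, b₂]` of `ℤ³`, coordinatewise. -/
theorem mem_Icc3_iff {a0 a1 a2 b0 b1 b2 : ℤ} {w : Site 3} :
    w ∈ Set.Icc (![a0, a1, a2] : Site 3) ![b0, b1, b2] ↔
      (a0 ≤ w 0 ∧ a1 ≤ w 1 ∧ a2 ≤ w 2) ∧ (w 0 ≤ b0 ∧ w 1 ≤ b1 ∧ w 2 ≤ b2) := by
  simp only [Set.mem_Icc, Pi.le_def, Fin.forall_fin_succ, IsEmpty.forall_iff, and_true,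
    Matrix.cons_val_zero, Matrix.cons_val_succ, Fin.succ_zero_eq_one, Fin.succ_one_eq_two]

/-- Multiplication by a sign preserves symmetric intervals. -/
theorem units_mul_mem {s : ℤˣ} {t M : ℤ} (h1 : -M ≤ t) (h2 : t ≤ M) :
    -M ≤ (s : ℤ) * t ∧ (s : ℤ) * t ≤ M := by
  rcases Int.units_eq_one_or s with rfl | rfl
  · simp only [Units.val_one, one_mul]; omega
  · simp only [Units.val_neg, Units.val_one, neg_mul, one_mul]; omega

/-- Along a unit step a signed coordinate increases by at most one. -/
theorem units_mul_le_add_one {s : ℤˣ} {a b : ℤ} (h : |a - b| ≤ 1) :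
    (s : ℤ) * b ≤ (s : ℤ) * a + 1 := by
  rw [abs_le] at h
  rcases Int.units_eq_one_or s with rfl | rfl
  · simp only [Units.val_one, one_mul]; omega
  · simp only [Units.val_neg, Units.val_one, neg_mul, one_mul]; omega

section Lids

variable {h : ℕ}

/-- **The lid in coordinates.** Let `φ` be a bijection of `ℤ³` whose inverse has coordinates
`(φ⁻¹ v)_j = s v_{π j} - w_j` with `π = swap 2 i`, `w = (-(2h+2), -(2h+2), h+2)` (the lid
automorphism `σ_{i,s} ∘ (· + w)`). For `v ∈ box (2h+2)`, `v ∈ φ([0, 4h+4]² × [a, b])` as soon as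
`a + h + 2 ≤ s v_i ≤ b + h + 2` (the two lateral coordinates are automatic). -/
theorem symm_mem_Icc {φ : zdGraph 3 ≃g zdGraph 3} {i : Fin 3} {s : ℤˣ}
    (hφ : ∀ (v : Site 3) (j : Fin 3), φ.symm v j = (s : ℤ) * v (Equiv.swap (2 : Fin 3) i j) -
      (![-(2 * (h : ℤ) + 2), -(2 * (h : ℤ) + 2), (h : ℤ) + 2] : Site 3) j)
    {v : Site 3} (hv : ∀ j, -(2 * (h : ℤ) + 2) ≤ v j ∧ v j ≤ 2 * (h : ℤ) + 2) {a b : ℤ}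
    (ha : a + ((h : ℤ) + 2) ≤ (s : ℤ) * v i)
    (hb : (s : ℤ) * v i ≤ 2 * (h : ℤ) + 2 → (s : ℤ) * v i ≤ b + ((h : ℤ) + 2)) :
    v ∈ φ '' Set.Icc (![0, 0, a] : Site 3) ![((4 * h + 4 : ℕ) : ℤ), ((4 * h + 4 : ℕ) : ℤ), b] := by
  have hε : ∀ k, -(2 * (h : ℤ) + 2) ≤ (s : ℤ) * v k ∧ (s : ℤ) * v k ≤ 2 * (h : ℤ) + 2 :=
    fun k => units_mul_mem (hv k).1 (hv k).2
  have h0 := hε (Equiv.swap (2 : Fin 3) i 0)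
  have h1 := hε (Equiv.swap (2 : Fin 3) i 1)
  have h2 := hb (hε i).2
  refine ⟨φ.symm v, ?_, RelIso.apply_symm_apply φ v⟩
  rw [mem_Icc3_iff]
  simp only [hφ, Equiv.swap_apply_left, Matrix.cons_val]
  push_cast
  omega

/-- Bottom and top of the reference piece are disjoint for `h ≥ 1`. -/
theorem not_mem_top_of_mem_bot (hh : 1 ≤ h) : ∀ a : Site 3,
    a ∈ Set.Icc (![0, 0, 0] : Site 3) ![((4 * h + 4 : ℕ) : ℤ), ((4 * h + 4 : ℕ) : ℤ), 0] →
      a ∉ Set.Icc (![0, 0, (h : ℤ)] : Site 3) ![((4 * h + 4 : ℕ) : ℤ), ((4 * h + 4 : ℕ) : ℤ), (h : ℤ)] := by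
  intro a ha ha'
  rw [mem_Icc3_iff] at ha ha'
  push_cast at ha ha'
  omega

/-- **Six-lid routing** (deterministic, lattice configurations). Let `φ q`, `q = (i, s)`, be the six
lid automorphisms (given through the coordinates of their inverses). Every open path of a lattice
configuration `ω ⊆ E(ℤ³)` inside `box (2h+2)` from `box (h+1)` to `∂ⁱⁿ box (2h+2)` contains an
open crossing of one of the six lids `φ q '' Q(4h+4, h)` from `φ q '' bottom` to `φ q '' top`,
inside that lid (last visit to `{s x_i ≤ h+1}`, `PathIn.last_exit`). -/
theorem routing {φ : Fin 3 × ℤˣ → zdGraph 3 ≃g zdGraph 3}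
    (hφ : ∀ (q : Fin 3 × ℤˣ) (v : Site 3) (j : Fin 3), (φ q).symm v j =
      (q.2 : ℤ) * v (Equiv.swap (2 : Fin 3) q.1 j) -
        (![-(2 * (h : ℤ) + 2), -(2 * (h : ℤ) + 2), (h : ℤ) + 2] : Site 3) j)
    {ω : BondConfig (Site 3)} (hω : ω ⊆ (zdGraph 3).edgeSet) {x y : Site 3}
    (hx : x ∈ box 3 (h + 1)) (hy : y ∈ innerBoundary (zdGraph 3) (box 3 (2 * (h + 1))))
    (hxy : ω ∈ openConnIn ((box 3 (2 * (h + 1)) : Finset (Site 3)) : Set (Site 3)) x y) :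
    ∃ q : Fin 3 × ℤˣ,
      ∃ b ∈ φ q '' Set.Icc (![0, 0, 0] : Site 3) ![((4 * h + 4 : ℕ) : ℤ), ((4 * h + 4 : ℕ) : ℤ), 0],
        ∃ y' ∈ φ q '' Set.Icc (![0, 0, (h : ℤ)] : Site 3)
            ![((4 * h + 4 : ℕ) : ℤ), ((4 * h + 4 : ℕ) : ℤ), (h : ℤ)],
          ω ∈ openConnIn (φ q '' Set.Icc (![0, 0, 0] : Site 3)
            ![((4 * h + 4 : ℕ) : ℤ), ((4 * h + 4 : ℕ) : ℤ), (h : ℤ)]) b y' := by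
  have hP := DCT16.pathIn_of_mem_openConnIn hxy
  have hbox : ∀ v ∈ ((box 3 (2 * (h + 1)) : Finset (Site 3)) : Set (Site 3)),
      ∀ j, -(2 * (h : ℤ) + 2) ≤ v j ∧ v j ≤ 2 * (h : ℤ) + 2 := by
    intro v hv j
    have h1 := (mem_box.1 (Finset.mem_coe.1 hv)) j
    push_cast at h1
    omega
  -- the face `{s v_i = 2h + 2}` on which the path ends, `q = (i, s)`
  obtain ⟨q, hs⟩ : ∃ q : Fin 3 × ℤˣ, (q.2 : ℤ) * y q.1 = 2 * (h : ℤ) + 2 := by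
    obtain ⟨i, hi | hi⟩ := exists_eq_of_mem_innerBoundary_box hy
    · exact ⟨(i, 1), show ((1 : ℤˣ) : ℤ) * y i = _ by rw [hi]; push_cast; ring⟩
    · exact ⟨(i, -1), show ((-1 : ℤˣ) : ℤ) * y i = _ by rw [hi]; push_cast; ring⟩
  -- last visit of the path to `C = {s v_i ≤ h + 1}`
  have hxC : x ∈ {v : Site 3 | (q.2 : ℤ) * v q.1 ≤ (h : ℤ) + 1} := by
    have h2 := units_mul_mem (s := q.2) ((mem_box.1 hx) q.1).1 ((mem_box.1 hx) q.1).2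
    push_cast at h2
    exact h2.2
  have hyC : y ∉ {v : Site 3 | (q.2 : ℤ) * v q.1 ≤ (h : ℤ) + 1} :=
    fun h' : (q.2 : ℤ) * y q.1 ≤ (h : ℤ) + 1 => by omega
  obtain ⟨a, b, haC, -, hbC, hab, hPb⟩ := hP.last_exit hxC hyC
  have hbi : (q.2 : ℤ) * b q.1 = (h : ℤ) + 2 := by
    have h1 := units_mul_le_add_one (s := q.2)
      (DCT16.abs_sub_le_one_of_adj (DCT16.adj_of_openGraph_adj hω hab) q.1)
    have h3 : (q.2 : ℤ) * a q.1 ≤ (h : ℤ) + 1 := haC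
    have h4 : ¬ ((q.2 : ℤ) * b q.1 ≤ (h : ℤ) + 1) := hbC
    omega
  refine ⟨q, b, symm_mem_Icc (hφ q) (hbox b hPb.left_mem.1) (by omega) (fun _ => by omega), y,
    symm_mem_Icc (hφ q) (hbox y hP.right_mem) (by omega) (fun _ => by omega),
    DCT16.mem_openConnIn_of_pathIn (hPb.mono fun v hv => ?_)⟩
  have h4 : ¬ ((q.2 : ℤ) * v q.1 ≤ (h : ℤ) + 1) := hv.2
  exact symm_mem_Icc (hφ q) (hbox v hv.1) (by omega) (fun h2 => by omega)

/-- **The six-lid inequality** `E_p[MinCut(h+1, 2h+2)] ≤ 6 · E_p[S(4h+4, h)]` for `h ≥ 1`: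
a.s. `MinCut(annulus) ≤ Σ_{six lids} MinCut(lid)` (routing + union of optimal cutsets), each lid
budget is finite and has expectation `E_p[S(4h+4, h)]` (lattice automorphisms), and all budgets are
integrable. -/
theorem integral_annulusMinCut_le (p : unitInterval) (hh : 1 ≤ h) :
    ∫ ω, ((minOpenCutIn (↑(box 3 (2 * (h + 1))) : Set (Site 3)) (↑(box 3 (h + 1)) : Set (Site 3))
        (↑(innerBoundary (zdGraph 3) (box 3 (2 * (h + 1)))) : Set (Site 3)) ω).toNat : ℝ)
        ∂(bondPercolation (zdGraph 3) p) ≤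
      6 * ∫ ω, ((minOpenCutIn
          (Set.Icc (![0, 0, 0] : Site 3) ![((4 * h + 4 : ℕ) : ℤ), ((4 * h + 4 : ℕ) : ℤ), (h : ℤ)])
          (Set.Icc (![0, 0, 0] : Site 3) ![((4 * h + 4 : ℕ) : ℤ), ((4 * h + 4 : ℕ) : ℤ), 0])
          (Set.Icc (![0, 0, (h : ℤ)] : Site 3) ![((4 * h + 4 : ℕ) : ℤ), ((4 * h + 4 : ℕ) : ℤ), (h : ℤ)])
          ω).toNat : ℝ) ∂(bondPercolation (zdGraph 3) p) := by
  have hBT := not_mem_top_of_mem_bot hh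
  set μ := bondPercolation (zdGraph 3) p
  set Q : Set (Site 3) :=
    Set.Icc (![0, 0, 0] : Site 3) ![((4 * h + 4 : ℕ) : ℤ), ((4 * h + 4 : ℕ) : ℤ), (h : ℤ)]
  set bot : Set (Site 3) := Set.Icc (![0, 0, 0] : Site 3) ![((4 * h + 4 : ℕ) : ℤ), ((4 * h + 4 : ℕ) : ℤ), 0]
  set top : Set (Site 3) :=
    Set.Icc (![0, 0, (h : ℤ)] : Site 3) ![((4 * h + 4 : ℕ) : ℤ), ((4 * h + 4 : ℕ) : ℤ), (h : ℤ)]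
  set Bo : Set (Site 3) := ↑(box 3 (2 * (h + 1)))
  set Bi : Set (Site 3) := ↑(box 3 (h + 1))
  set Bd : Set (Site 3) := ↑(innerBoundary (zdGraph 3) (box 3 (2 * (h + 1))))
  -- the six lid automorphisms `Φ_{i,s} = σ_{i,s} ∘ (· + w_h)`, through the coordinates of their inverses
  obtain ⟨φ, hφ⟩ : ∃ φ : Fin 3 × ℤˣ → zdGraph 3 ≃g zdGraph 3,
      ∀ (q : Fin 3 × ℤˣ) (v : Site 3) (j : Fin 3), (φ q).symm v j =
        (q.2 : ℤ) * v (Equiv.swap (2 : Fin 3) q.1 j) -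
          (![-(2 * (h : ℤ) + 2), -(2 * (h : ℤ) + 2), (h : ℤ) + 2] : Site 3) j :=
    ⟨fun q => RelIso.trans
        (zdShiftIso (![-(2 * (h : ℤ) + 2), -(2 * (h : ℤ) + 2), (h : ℤ) + 2] : Site 3))
        (zdSignedPermIso (Equiv.swap (2 : Fin 3) q.1) fun _ => q.2),
      fun q v j => by
        show (RelIso.trans (zdShiftIso _) (zdSignedPermIso _ _)).symm v j = _
        rw [RelIso.symm_trans_apply]
        change (Site.shift (![-(2 * (h : ℤ) + 2), -(2 * (h : ℤ) + 2), (h : ℤ) + 2] : Site 3)).symm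
          ((Site.signedPerm (Equiv.swap (2 : Fin 3) q.1) fun _ => q.2).symm v) j = _
        rw [Site.shift_symm_apply, Pi.sub_apply, Site.signedPerm_symm_apply]⟩
  -- a.s. `MinCut(annulus) ≤ Σ_q MinCut(lid q)` (routing + union of optimal cutsets), lid budgets finite
  have hpt : ∀ᵐ ω ∂μ, ((minOpenCutIn Bo Bi Bd ω).toNat : ℝ) ≤
      ∑ q : Fin 3 × ℤˣ, ((minOpenCutIn (φ q '' Q) (φ q '' bot) (φ q '' top) ω).toNat : ℝ) := by
    filter_upwards [(setBernoulli_ae_subset : ∀ᵐ ω ∂μ, ω ⊆ (zdGraph 3).edgeSet)] with ω hω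
    have h1 : minOpenCutIn Bo Bi Bd ω ≤
        ∑ q : Fin 3 × ℤˣ, minOpenCutIn (φ q '' Q) (φ q '' bot) (φ q '' top) ω :=
      minOpenCutIn_le_sum_of_subRouting fun ω' hω' ⟨x, hx, y, hy, hxy⟩ =>
        routing hφ (hω'.trans hω) hx hy hxy
    have h2 : ∀ q : Fin 3 × ℤˣ, minOpenCutIn (φ q '' Q) (φ q '' bot) (φ q '' top) ω ≠ ⊤ := fun q =>
      minOpenCutIn_image_ne_top (RelIso.injective (φ q)) (Set.finite_Icc _ _) hBT ω
    have h3 := (ENat.toNat_le_toNat h1 (ENat.sum_ne_top.2 fun q _ => h2 q)).trans_eq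
      (ENat.toNat_sum fun q _ => h2 q)
    exact_mod_cast h3
  have hint : ∀ q : Fin 3 × ℤˣ,
      Integrable (fun ω => ((minOpenCutIn (φ q '' Q) (φ q '' bot) (φ q '' top) ω).toNat : ℝ)) μ :=
    fun q => integrable_toNat_minOpenCutIn ((Set.finite_Icc _ _).image _) _ _ _ _
  calc ∫ ω, ((minOpenCutIn Bo Bi Bd ω).toNat : ℝ) ∂μ
      ≤ ∫ ω, ∑ q : Fin 3 × ℤˣ, ((minOpenCutIn (φ q '' Q) (φ q '' bot) (φ q '' top) ω).toNat : ℝ) ∂μ :=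
        integral_mono_ae (integrable_toNat_minOpenCutIn (Finset.finite_toSet _) _ _ _ _)
          (integrable_finsetSum _ fun q _ => hint q) hpt
    _ = ∑ q : Fin 3 × ℤˣ, ∫ ω, ((minOpenCutIn (φ q '' Q) (φ q '' bot) (φ q '' top) ω).toNat : ℝ) ∂μ :=
        integral_finsetSum _ fun q _ => hint q
    _ = ∑ _q : Fin 3 × ℤˣ, ∫ ω, ((minOpenCutIn Q bot top ω).toNat : ℝ) ∂μ :=
        Finset.sum_congr rfl fun q _ => integral_toNat_minOpenCutIn_image (φ q) p Q bot top
    _ = 6 * ∫ ω, ((minOpenCutIn Q bot top ω).toNat : ℝ) ∂μ := by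
        rw [Finset.sum_const, Finset.card_univ, nsmul_eq_mul]
        norm_num [Fintype.card_prod, Fintype.card_units_int]

end Lids

end StubSixLids

/-- **`stub_sixLids` (registered stub of line `Sketch`, crux stmt-CriticalPhenomena-5248): the
six-lid inequality** `E_p[MinCut(h+1, 2h+2)] ≤ 6 · E_p[S(4h+4, h)]` for every `p` and `h ≥ 1`: every
open crossing of the annulus `box (h+1) → ∂ⁱⁿ box (2h+2)` crosses one of the six lids
`{±x_i ≥ h+2} ∩ box (2h+2) ≅ [0, 4h+4]² × [0, h]` from bottom to top, so the union of six optimal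
lid cutsets is an annulus cutset (a.s.), and each lid has the expected budget of the reference
piece by invariance of `P_p` under lattice automorphisms. -/
theorem stub_sixLids :
    ∀ (p : unitInterval) (h : ℕ), 1 ≤ h →
      ∫ ω, ((minOpenCutIn (↑(box 3 (2 * (h + 1))) : Set (Site 3)) (↑(box 3 (h + 1)) : Set (Site 3))
          (↑(innerBoundary (zdGraph 3) (box 3 (2 * (h + 1)))) : Set (Site 3)) ω).toNat : ℝ)
          ∂(bondPercolation (zdGraph 3) p) ≤
      6 * ∫ ω, ((minOpenCutIn
          (Set.Icc (![0, 0, 0] : Site 3) ![((4 * h + 4 : ℕ) : ℤ), ((4 * h + 4 : ℕ) : ℤ), (h : ℤ)])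
          (Set.Icc (![0, 0, 0] : Site 3) ![((4 * h + 4 : ℕ) : ℤ), ((4 * h + 4 : ℕ) : ℤ), 0])
          (Set.Icc (![0, 0, (h : ℤ)] : Site 3) ![((4 * h + 4 : ℕ) : ℤ), ((4 * h + 4 : ℕ) : ℤ), (h : ℤ)])
          ω).toNat : ℝ) ∂(bondPercolation (zdGraph 3) p) :=
  fun p _ hh => StubSixLids.integral_annulusMinCut_le p hh

end Summit.CriticalPhenomena.PercolationContinuityZ3.Theorems.BudgetTightness

end
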